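import Summits.CriticalPhenomena.PercolationContinuityZ3.Theorems.PercNearOneGluingNoHeavyLowerTailSunflowerDoublyCompletingKernelA
import HarnessLib

/-!
# `NoHeavyLowerTail` (crux stmt-CriticalPhenomena-4575), abstract sunflower cubic: ★ behind a DOUBLY COMPLETING PAIR — the finite KERNEL CHECK,
# part B (sorted code triples with first code `≥ 14`, and the assembly over all sorted triples)

Support file (seat `prim-ineq-gen-2` gen 25; `--supports stmt-CriticalPhenomena-4575`).  No `sorry`, no named facts.  Continuation of
`…DoublyCompletingKernelA` (kernel `dcKer`, codes `dcCode`); the theorem is assembled in `…DoublyCompleting`.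
Memo: run/shared/lean/prim/prim-ineq-gen-2/TWO-POINT-GEN25.md.
-/

namespace Summit.CriticalPhenomena.PercolationContinuityZ3.Theorems.SunflowerPartition

open Finset


/-- Kernel check, first code `14`, second code `< 27`. [this work] -/
theorem dcKer_symm_nonneg_14a : ∀ b c : Fin 42, (14 : Fin 42) ≤ b → b ≤ c → b.val < 27 → 0 ≤ symm6Of dcKer (dcCode 14) (dcCode b) (dcCode c) := by
  decide +kernel

/-- Kernel check, first code `14`, second code `≥ 27`. [this work] -/
theorem dcKer_symm_nonneg_14b : ∀ b c : Fin 42, (14 : Fin 42) ≤ b → b ≤ c → 27 ≤ b.val → 0 ≤ symm6Of dcKer (dcCode 14) (dcCode b) (dcCode c) := by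
  decide +kernel

/-- Kernel check, first code `15`, second code `< 30`. [this work] -/
theorem dcKer_symm_nonneg_15a : ∀ b c : Fin 42, (15 : Fin 42) ≤ b → b ≤ c → b.val < 30 → 0 ≤ symm6Of dcKer (dcCode 15) (dcCode b) (dcCode c) := by
  decide +kernel

/-- Kernel check, first code `15`, second code `≥ 30`. [this work] -/
theorem dcKer_symm_nonneg_15b : ∀ b c : Fin 42, (15 : Fin 42) ≤ b → b ≤ c → 30 ≤ b.val → 0 ≤ symm6Of dcKer (dcCode 15) (dcCode b) (dcCode c) := by
  decide +kernel

/-- Kernel check, first code `16`, second code `< 32`. [this work] -/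
theorem dcKer_symm_nonneg_16a : ∀ b c : Fin 42, (16 : Fin 42) ≤ b → b ≤ c → b.val < 32 → 0 ≤ symm6Of dcKer (dcCode 16) (dcCode b) (dcCode c) := by
  decide +kernel

/-- Kernel check, first code `16`, second code `≥ 32`. [this work] -/
theorem dcKer_symm_nonneg_16b : ∀ b c : Fin 42, (16 : Fin 42) ≤ b → b ≤ c → 32 ≤ b.val → 0 ≤ symm6Of dcKer (dcCode 16) (dcCode b) (dcCode c) := by
  decide +kernel

/-- Kernel check, first code `17`, second code `< 35`. [this work] -/
theorem dcKer_symm_nonneg_17a : ∀ b c : Fin 42, (17 : Fin 42) ≤ b → b ≤ c → b.val < 35 → 0 ≤ symm6Of dcKer (dcCode 17) (dcCode b) (dcCode c) := by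
  decide +kernel

/-- Kernel check, first code `17`, second code `≥ 35`. [this work] -/
theorem dcKer_symm_nonneg_17b : ∀ b c : Fin 42, (17 : Fin 42) ≤ b → b ≤ c → 35 ≤ b.val → 0 ≤ symm6Of dcKer (dcCode 17) (dcCode b) (dcCode c) := by
  decide +kernel

/-- Kernel check, first code `18`. [this work] -/
theorem dcKer_symm_nonneg_18 : ∀ b c : Fin 42, (18 : Fin 42) ≤ b → b ≤ c → 0 ≤ symm6Of dcKer (dcCode 18) (dcCode b) (dcCode c) := by
  decide +kernel

/-- Kernel check, first code `19`. [this work] -/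
theorem dcKer_symm_nonneg_19 : ∀ b c : Fin 42, (19 : Fin 42) ≤ b → b ≤ c → 0 ≤ symm6Of dcKer (dcCode 19) (dcCode b) (dcCode c) := by
  decide +kernel

/-- Kernel check, first code `20`. [this work] -/
theorem dcKer_symm_nonneg_20 : ∀ b c : Fin 42, (20 : Fin 42) ≤ b → b ≤ c → 0 ≤ symm6Of dcKer (dcCode 20) (dcCode b) (dcCode c) := by
  decide +kernel

/-- Kernel check, first code `21`. [this work] -/
theorem dcKer_symm_nonneg_21 : ∀ b c : Fin 42, (21 : Fin 42) ≤ b → b ≤ c → 0 ≤ symm6Of dcKer (dcCode 21) (dcCode b) (dcCode c) := by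
  decide +kernel

/-- Kernel check, first code `22`. [this work] -/
theorem dcKer_symm_nonneg_22 : ∀ b c : Fin 42, (22 : Fin 42) ≤ b → b ≤ c → 0 ≤ symm6Of dcKer (dcCode 22) (dcCode b) (dcCode c) := by
  decide +kernel

/-- Kernel check, first code `23`. [this work] -/
theorem dcKer_symm_nonneg_23 : ∀ b c : Fin 42, (23 : Fin 42) ≤ b → b ≤ c → 0 ≤ symm6Of dcKer (dcCode 23) (dcCode b) (dcCode c) := by
  decide +kernel

/-- Kernel check, first code `24`. [this work] -/
theorem dcKer_symm_nonneg_24 : ∀ b c : Fin 42, (24 : Fin 42) ≤ b → b ≤ c → 0 ≤ symm6Of dcKer (dcCode 24) (dcCode b) (dcCode c) := by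
  decide +kernel

/-- Kernel check, first code `25`. [this work] -/
theorem dcKer_symm_nonneg_25 : ∀ b c : Fin 42, (25 : Fin 42) ≤ b → b ≤ c → 0 ≤ symm6Of dcKer (dcCode 25) (dcCode b) (dcCode c) := by
  decide +kernel

/-- Kernel check, first code `26`. [this work] -/
theorem dcKer_symm_nonneg_26 : ∀ b c : Fin 42, (26 : Fin 42) ≤ b → b ≤ c → 0 ≤ symm6Of dcKer (dcCode 26) (dcCode b) (dcCode c) := by
  decide +kernel

/-- Kernel check, first code `27`. [this work] -/
theorem dcKer_symm_nonneg_27 : ∀ b c : Fin 42, (27 : Fin 42) ≤ b → b ≤ c → 0 ≤ symm6Of dcKer (dcCode 27) (dcCode b) (dcCode c) := by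
  decide +kernel

/-- Kernel check, first code `28`. [this work] -/
theorem dcKer_symm_nonneg_28 : ∀ b c : Fin 42, (28 : Fin 42) ≤ b → b ≤ c → 0 ≤ symm6Of dcKer (dcCode 28) (dcCode b) (dcCode c) := by
  decide +kernel

/-- Kernel check, first code `29`. [this work] -/
theorem dcKer_symm_nonneg_29 : ∀ b c : Fin 42, (29 : Fin 42) ≤ b → b ≤ c → 0 ≤ symm6Of dcKer (dcCode 29) (dcCode b) (dcCode c) := by
  decide +kernel

/-- Kernel check, first code `30`. [this work] -/
theorem dcKer_symm_nonneg_30 : ∀ b c : Fin 42, (30 : Fin 42) ≤ b → b ≤ c → 0 ≤ symm6Of dcKer (dcCode 30) (dcCode b) (dcCode c) := by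
  decide +kernel

/-- Kernel check, first code `31`. [this work] -/
theorem dcKer_symm_nonneg_31 : ∀ b c : Fin 42, (31 : Fin 42) ≤ b → b ≤ c → 0 ≤ symm6Of dcKer (dcCode 31) (dcCode b) (dcCode c) := by
  decide +kernel

/-- Kernel check, first code `32`. [this work] -/
theorem dcKer_symm_nonneg_32 : ∀ b c : Fin 42, (32 : Fin 42) ≤ b → b ≤ c → 0 ≤ symm6Of dcKer (dcCode 32) (dcCode b) (dcCode c) := by
  decide +kernel

/-- Kernel check, first code `33`. [this work] -/
theorem dcKer_symm_nonneg_33 : ∀ b c : Fin 42, (33 : Fin 42) ≤ b → b ≤ c → 0 ≤ symm6Of dcKer (dcCode 33) (dcCode b) (dcCode c) := by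
  decide +kernel

/-- Kernel check, first code `34`. [this work] -/
theorem dcKer_symm_nonneg_34 : ∀ b c : Fin 42, (34 : Fin 42) ≤ b → b ≤ c → 0 ≤ symm6Of dcKer (dcCode 34) (dcCode b) (dcCode c) := by
  decide +kernel

/-- Kernel check, first code `35`. [this work] -/
theorem dcKer_symm_nonneg_35 : ∀ b c : Fin 42, (35 : Fin 42) ≤ b → b ≤ c → 0 ≤ symm6Of dcKer (dcCode 35) (dcCode b) (dcCode c) := by
  decide +kernel

/-- Kernel check, first code `36`. [this work] -/
theorem dcKer_symm_nonneg_36 : ∀ b c : Fin 42, (36 : Fin 42) ≤ b → b ≤ c → 0 ≤ symm6Of dcKer (dcCode 36) (dcCode b) (dcCode c) := by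
  decide +kernel

/-- Kernel check, first code `37`. [this work] -/
theorem dcKer_symm_nonneg_37 : ∀ b c : Fin 42, (37 : Fin 42) ≤ b → b ≤ c → 0 ≤ symm6Of dcKer (dcCode 37) (dcCode b) (dcCode c) := by
  decide +kernel

/-- Kernel check, first code `38`. [this work] -/
theorem dcKer_symm_nonneg_38 : ∀ b c : Fin 42, (38 : Fin 42) ≤ b → b ≤ c → 0 ≤ symm6Of dcKer (dcCode 38) (dcCode b) (dcCode c) := by
  decide +kernel

/-- Kernel check, first code `39`. [this work] -/
theorem dcKer_symm_nonneg_39 : ∀ b c : Fin 42, (39 : Fin 42) ≤ b → b ≤ c → 0 ≤ symm6Of dcKer (dcCode 39) (dcCode b) (dcCode c) := by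
  decide +kernel

/-- Kernel check, first code `40`. [this work] -/
theorem dcKer_symm_nonneg_40 : ∀ b c : Fin 42, (40 : Fin 42) ≤ b → b ≤ c → 0 ≤ symm6Of dcKer (dcCode 40) (dcCode b) (dcCode c) := by
  decide +kernel

/-- Kernel check, first code `41`. [this work] -/
theorem dcKer_symm_nonneg_41 : ∀ b c : Fin 42, (41 : Fin 42) ≤ b → b ≤ c → 0 ≤ symm6Of dcKer (dcCode 41) (dcCode b) (dcCode c) := by
  decide +kernel

/-- **Kernel check on sorted code triples** (all `42³` triples follow by symmetry, `…DoublyCompleting`). [this work] -/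
theorem dcKer_symm_nonneg_sorted : ∀ a b c : Fin 42, a ≤ b → b ≤ c → 0 ≤ symm6Of dcKer (dcCode a) (dcCode b) (dcCode c) := by
  intro a
  fin_cases a
  · exact fun b c h1 h2 => if hb0 : b.val < 7 then dcKer_symm_nonneg_0a b c h1 h2 hb0 else
      if hb1 : b.val < 16 then dcKer_symm_nonneg_0b b c h1 h2 (by omega) hb1 else
      if hb2 : b.val < 32 then dcKer_symm_nonneg_0c b c h1 h2 (by omega) hb2 else
      dcKer_symm_nonneg_0d b c h1 h2 (by omega)
  · exact fun b c h1 h2 => if hb0 : b.val < 9 then dcKer_symm_nonneg_1a b c h1 h2 hb0 else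
      if hb1 : b.val < 19 then dcKer_symm_nonneg_1b b c h1 h2 (by omega) hb1 else
      dcKer_symm_nonneg_1c b c h1 h2 (by omega)
  · exact fun b c h1 h2 => if hb0 : b.val < 10 then dcKer_symm_nonneg_2a b c h1 h2 hb0 else
      if hb1 : b.val < 21 then dcKer_symm_nonneg_2b b c h1 h2 (by omega) hb1 else
      dcKer_symm_nonneg_2c b c h1 h2 (by omega)
  · exact fun b c h1 h2 => if hb0 : b.val < 11 then dcKer_symm_nonneg_3a b c h1 h2 hb0 else
      if hb1 : b.val < 22 then dcKer_symm_nonneg_3b b c h1 h2 (by omega) hb1 else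
      dcKer_symm_nonneg_3c b c h1 h2 (by omega)
  · exact fun b c h1 h2 => if hb0 : b.val < 12 then dcKer_symm_nonneg_4a b c h1 h2 hb0 else
      if hb1 : b.val < 24 then dcKer_symm_nonneg_4b b c h1 h2 (by omega) hb1 else
      dcKer_symm_nonneg_4c b c h1 h2 (by omega)
  · exact fun b c h1 h2 => if hb0 : b.val < 14 then dcKer_symm_nonneg_5a b c h1 h2 hb0 else
      if hb1 : b.val < 27 then dcKer_symm_nonneg_5b b c h1 h2 (by omega) hb1 else
      dcKer_symm_nonneg_5c b c h1 h2 (by omega)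
  · exact fun b c h1 h2 => if hb0 : b.val < 15 then dcKer_symm_nonneg_6a b c h1 h2 hb0 else
      if hb1 : b.val < 30 then dcKer_symm_nonneg_6b b c h1 h2 (by omega) hb1 else
      dcKer_symm_nonneg_6c b c h1 h2 (by omega)
  · exact fun b c h1 h2 => if hb0 : b.val < 16 then dcKer_symm_nonneg_7a b c h1 h2 hb0 else
      if hb1 : b.val < 32 then dcKer_symm_nonneg_7b b c h1 h2 (by omega) hb1 else
      dcKer_symm_nonneg_7c b c h1 h2 (by omega)
  · exact fun b c h1 h2 => if hb0 : b.val < 18 then dcKer_symm_nonneg_8a b c h1 h2 hb0 else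
      dcKer_symm_nonneg_8b b c h1 h2 (by omega)
  · exact fun b c h1 h2 => if hb0 : b.val < 19 then dcKer_symm_nonneg_9a b c h1 h2 hb0 else
      dcKer_symm_nonneg_9b b c h1 h2 (by omega)
  · exact fun b c h1 h2 => if hb0 : b.val < 21 then dcKer_symm_nonneg_10a b c h1 h2 hb0 else
      dcKer_symm_nonneg_10b b c h1 h2 (by omega)
  · exact fun b c h1 h2 => if hb0 : b.val < 22 then dcKer_symm_nonneg_11a b c h1 h2 hb0 else
      dcKer_symm_nonneg_11b b c h1 h2 (by omega)
  · exact fun b c h1 h2 => if hb0 : b.val < 24 then dcKer_symm_nonneg_12a b c h1 h2 hb0 else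
      dcKer_symm_nonneg_12b b c h1 h2 (by omega)
  · exact fun b c h1 h2 => if hb0 : b.val < 26 then dcKer_symm_nonneg_13a b c h1 h2 hb0 else
      dcKer_symm_nonneg_13b b c h1 h2 (by omega)
  · exact fun b c h1 h2 => if hb0 : b.val < 27 then dcKer_symm_nonneg_14a b c h1 h2 hb0 else
      dcKer_symm_nonneg_14b b c h1 h2 (by omega)
  · exact fun b c h1 h2 => if hb0 : b.val < 30 then dcKer_symm_nonneg_15a b c h1 h2 hb0 else
      dcKer_symm_nonneg_15b b c h1 h2 (by omega)
  · exact fun b c h1 h2 => if hb0 : b.val < 32 then dcKer_symm_nonneg_16a b c h1 h2 hb0 else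
      dcKer_symm_nonneg_16b b c h1 h2 (by omega)
  · exact fun b c h1 h2 => if hb0 : b.val < 35 then dcKer_symm_nonneg_17a b c h1 h2 hb0 else
      dcKer_symm_nonneg_17b b c h1 h2 (by omega)
  · exact dcKer_symm_nonneg_18
  · exact dcKer_symm_nonneg_19
  · exact dcKer_symm_nonneg_20
  · exact dcKer_symm_nonneg_21
  · exact dcKer_symm_nonneg_22
  · exact dcKer_symm_nonneg_23
  · exact dcKer_symm_nonneg_24
  · exact dcKer_symm_nonneg_25
  · exact dcKer_symm_nonneg_26
  · exact dcKer_symm_nonneg_27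
  · exact dcKer_symm_nonneg_28
  · exact dcKer_symm_nonneg_29
  · exact dcKer_symm_nonneg_30
  · exact dcKer_symm_nonneg_31
  · exact dcKer_symm_nonneg_32
  · exact dcKer_symm_nonneg_33
  · exact dcKer_symm_nonneg_34
  · exact dcKer_symm_nonneg_35
  · exact dcKer_symm_nonneg_36
  · exact dcKer_symm_nonneg_37
  · exact dcKer_symm_nonneg_38
  · exact dcKer_symm_nonneg_39
  · exact dcKer_symm_nonneg_40
  · exact dcKer_symm_nonneg_41

end Summit.CriticalPhenomena.PercolationContinuityZ3.Theorems.SunflowerPartition
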